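import Literature.NumberTheory.EllipticCurves.Gamma0EisensteinHeckeIdentity
import HarnessLib

/-!
# The Eisenstein series of the cusp `∞` of `Γ₀(N)`, III: the uniform bound
# `(s − 1) G₁(w, s) ≤ 60 (1 + (Im w)²)` for `Im w ≥ 1/2`, `1 < s ≤ 2`

Topic `Literature/NumberTheory/EllipticCurves`; theorems only (no definition, no named fact). Sixth
brick of the printed proof behind the named fact `murty_petersson_newform_lower_bound` (Murty 1999,
§2: Rankin–Selberg, then Hoffstein–Lockhart): the domination needed to pass to the limit `s → 1⁺`
under the integral sign in the unfolded identity. With `G_N(z, s) = Σ_{(c,d)=1, N∣c}(y/|cz+d|²)ˢ`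
(`= 2E_∞^{Γ₀(N)}(z, s)`):

1. `tsum_pnat_rpow_neg_le`: `ζ⁺(σ) = Σ_{m≥1} m^{-σ} ≤ 1 + 1/(σ−1)` (integral test,
   Mathlib `AntitoneOn.sum_le_integral`, `integral_rpow`).
2. `sum_range_sq_add_sq_rpow_neg_le`, `tsum_int_sq_add_sq_rpow_neg_le`: **the row bound**
   `Σ_{d∈ℤ} ((d+a)² + b²)^{-s} ≤ 2b^{-2s} + πb^{1-2s}` (`b > 0`, `s ≥ 1`): shift by `⌊a⌋`, split
   `ℤ = ℕ ⊔ (−ℕ⁺)`, integral test against `b^{-2s}(1 + (u/b)²)⁻¹` (`∫ = b·arctan`).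
3. `tsum_int_row_zero_le` (`c = 0`: `Σ_d (y/d²)ˢ ≤ 4yˢ`), `tsum_int_row_le` (`c ≠ 0`),
   `tsum_int_rowBound_le` (the column sum, with `ζ⁺(2s) ≤ 2`, `ζ⁺(2s−1) ≤ 1 + 1/(2(s−1))`),
   `tsum_pairs_le`: **`Σ_{p∈ℤ²}(y/|p₀w+p₁|²)ˢ ≤ 4yˢ + 8y^{-s} + 2πy^{1-s}(1 + 1/(2(s−1)))`**
   (all in `ℝ≥0∞`; the classical estimate `E(z,s) ≪ yˢ + y^{1-s}/(s−1)`, Iwaniec §3.2, (3.20)).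
4. `sub_one_mul_tsum_coprime_le`: **`(s − 1) G₁(w, s) ≤ 60 (1 + (Im w)²)`** for `Im w ≥ 1/2`,
   `1 < s ≤ 2` (drop the coprimality, then 3.; `yˢ ≤ 1 + y²`, `y^{-s} ≤ 4`, `y^{1-s} ≤ 2`, `π ≤ 4`).
5. `tsum_coprime_smul`: `G₁(Az, s) = G₁(z, s)` for `A ∈ SL(2, ℤ)` (the tree's `eisensteinE_smul`);
   `tsum_coprime_dvd_le_tsum_coprime`: `G_N ≤ G₁`.

## References

* [Iwaniec2002] H. Iwaniec, *Spectral Methods of Automorphic Forms*, GSM 53, §3.2 ((3.20):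
  `E(z, s) ≪ y^σ` in `𝒟`, `σ > 1`; Thm. 3.4 / (3.29) for the `y^{1-s}` term).
* [DiamondShurman2005] F. Diamond, J. Shurman, GTM 228, §4.2, Ex. 4.2.? (convergence estimates for
  Eisenstein series).
* [Murty1999CongruencePrimes] M. R. Murty, *Bounds for congruence primes* (1999), §2.
-/

noncomputable section

open scoped Real Topology ENNReal NNReal UpperHalfPlane MatrixGroups
open MeasureTheory Set Filter intervalIntegral
open Literature.NumberTheory.Automorphic

namespace Literature.NumberTheory.EllipticCurves.ModularForms


/-! ### `ζ(σ) ≤ 1 + 1/(σ − 1)` -/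

section ZetaTail

/-- `Σ_{m=2}^{M+1} m^{-σ} ≤ ∫₁^{M+1} u^{-σ} du ≤ 1/(σ − 1)` (`σ > 1`; integral test). [folklore] -/
theorem sum_range_rpow_neg_le {σ : ℝ} (hσ : 1 < σ) (M : ℕ) :
    ∑ i ∈ Finset.range M, ((1 : ℝ) + (i + 1 : ℕ)) ^ (-σ) ≤ 1 / (σ - 1) := by
  have hanti : AntitoneOn (fun u : ℝ ↦ u ^ (-σ)) (Icc (1 : ℝ) (1 + M)) := by
    intro u hu v hv huv
    exact Real.rpow_le_rpow_of_nonpos (by linarith [hu.1]) huv (by linarith)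
  have h := AntitoneOn.sum_le_integral (f := fun u : ℝ ↦ u ^ (-σ)) (x₀ := 1) (a := M) hanti
  refine h.trans ?_
  have hM0 : (1 : ℝ) ≤ 1 + M := by
    have : (0 : ℝ) ≤ M := Nat.cast_nonneg M
    linarith
  have h0 : (0 : ℝ) ∉ Set.uIcc (1 : ℝ) (1 + M) := by
    rw [Set.uIcc_of_le hM0]
    intro h0
    exact absurd h0.1 (by norm_num)
  rw [integral_rpow (Or.inr ⟨by linarith, h0⟩), Real.one_rpow]
  rw [show -σ + 1 = -(σ - 1) by ring, div_neg, ← neg_div, neg_sub]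
  have hA : 0 ≤ ((1 : ℝ) + M) ^ (-(σ - 1)) := Real.rpow_nonneg (by linarith) _
  exact div_le_div_of_nonneg_right (by linarith) (by linarith)

/-- **`ζ(σ) ≤ 1 + 1/(σ − 1)` for real `σ > 1`**, for the real sum `Σ_{m ≥ 1} m^{-σ}` over `ℕ⁺`.
[folklore] -/
theorem tsum_pnat_rpow_neg_le {σ : ℝ} (hσ : 1 < σ) :
    ∑' m : ℕ+, ((m : ℕ) : ℝ) ^ (-σ) ≤ 1 + 1 / (σ - 1) := by
  have hsumN : Summable fun n : ℕ ↦ ((n + 1 : ℕ) : ℝ) ^ (-σ) :=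
    (Real.summable_nat_rpow.mpr (by linarith : -σ < -1)).comp_injective Nat.succ_injective
  -- pass to `ℕ` via `m = n + 1`
  have heq : ∑' m : ℕ+, ((m : ℕ) : ℝ) ^ (-σ) = ∑' n : ℕ, ((n + 1 : ℕ) : ℝ) ^ (-σ) :=
    (Equiv.pnatEquivNat.symm.tsum_eq (fun m : ℕ+ ↦ ((m : ℕ) : ℝ) ^ (-σ))).symm.trans
      (tsum_congr fun n ↦ by simp [Equiv.pnatEquivNat, Nat.succPNat])
  rw [heq, hsumN.tsum_eq_zero_add]
  simp only [zero_add, Nat.cast_one, Real.one_rpow, add_le_add_iff_left]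
  refine Real.tsum_le_of_sum_range_le (fun n ↦ Real.rpow_nonneg (by positivity) _) fun M ↦ ?_
  refine le_trans (le_of_eq (Finset.sum_congr rfl fun i _ ↦ ?_)) (sum_range_rpow_neg_le hσ M)
  push_cast
  ring_nf

end ZetaTail

/-! ### The row bound -/

section RowBound

/-- `Σ_{k=1}^{K} (k² + b²)^{-s} ≤ ∫₀^K (u² + b²)^{-s} du ≤ b^{-2s}∫₀^K (1+(u/b)²)⁻¹ du
= b^{1-2s} arctan(K/b) ≤ (π/2) b^{1−2s}` (`b > 0`, `s ≥ 1`). [folklore] -/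
theorem sum_range_sq_add_sq_rpow_neg_le {b s : ℝ} (hb : 0 < b) (hs : 1 ≤ s) (K : ℕ) :
    ∑ i ∈ Finset.range K, (((0 : ℝ) + (i + 1 : ℕ)) ^ 2 + b ^ 2) ^ (-s) ≤ π / 2 * b ^ (1 - 2 * s) := by
  have hanti : AntitoneOn (fun u : ℝ ↦ (u ^ 2 + b ^ 2) ^ (-s)) (Icc (0 : ℝ) (0 + K)) := by
    intro u hu v hv huv
    apply Real.rpow_le_rpow_of_nonpos (by positivity) ?_ (by linarith)
    have := hu.1
    nlinarith
  have h := AntitoneOn.sum_le_integral (f := fun u : ℝ ↦ (u ^ 2 + b ^ 2) ^ (-s)) (x₀ := 0) (a := K) hanti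
  refine h.trans ?_
  rw [zero_add]
  -- compare with `b^{-2s} (1 + (u/b)²)⁻¹`
  have hpt : ∀ u ∈ Icc (0 : ℝ) K, (u ^ 2 + b ^ 2) ^ (-s) ≤ b ^ (-(2 * s)) * (1 + (u / b) ^ 2)⁻¹ := by
    intro u hu
    have hfac : u ^ 2 + b ^ 2 = b ^ 2 * (1 + (u / b) ^ 2) := by field_simp; ring
    rw [hfac, Real.mul_rpow (by positivity) (by positivity)]
    have hb2 : (b ^ 2) ^ (-s) = b ^ (-(2 * s)) := by
      rw [← Real.rpow_natCast b 2, ← Real.rpow_mul hb.le]; norm_num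
    rw [hb2]
    refine mul_le_mul_of_nonneg_left ?_ (Real.rpow_nonneg hb.le _)
    rw [← Real.rpow_neg_one]
    exact Real.rpow_le_rpow_of_exponent_le (by nlinarith [sq_nonneg (u / b)]) (by linarith)
  have hint1 : IntervalIntegrable (fun u : ℝ ↦ (u ^ 2 + b ^ 2) ^ (-s)) volume 0 K := by
    refine (Continuous.rpow_const (by fun_prop) fun u ↦ Or.inl ?_).intervalIntegrable _ _
    exact (add_pos_of_nonneg_of_pos (sq_nonneg u) (pow_pos hb 2)).ne'
  have hint2 : IntervalIntegrable (fun u : ℝ ↦ b ^ (-(2 * s)) * (1 + (u / b) ^ 2)⁻¹) volume 0 K := by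
    refine (continuous_const.mul ((continuous_const.add ((continuous_id.div_const b).pow 2)).inv₀
      fun u ↦ ?_)).intervalIntegrable _ _
    exact (add_pos_of_pos_of_nonneg one_pos (sq_nonneg _)).ne'
  refine (intervalIntegral.integral_mono_on (by positivity) hint1 hint2 hpt).trans ?_
  rw [intervalIntegral.integral_const_mul, intervalIntegral.integral_comp_div (fun x : ℝ ↦ (1 + x ^ 2)⁻¹) hb.ne',
    zero_div, integral_inv_one_add_sq, Real.arctan_zero, sub_zero, smul_eq_mul]
  have harc : Real.arctan (K / b) ≤ π / 2 := (Real.arctan_lt_pi_div_two _).le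
  have hb2s : 0 ≤ b ^ (-(2 * s)) := Real.rpow_nonneg hb.le _
  calc b ^ (-(2 * s)) * (b * Real.arctan (K / b)) ≤ b ^ (-(2 * s)) * (b * (π / 2)) := by
        gcongr
    _ = π / 2 * b ^ (1 - 2 * s) := by
        rw [show (1 : ℝ) - 2 * s = -(2 * s) + 1 by ring, Real.rpow_add hb, Real.rpow_one]
        ring

/-- **The row bound** `Σ_{d∈ℤ} ((d + a)² + b²)^{-s} ≤ 2b^{-2s} + πb^{1−2s}` (`a ∈ ℝ`, `b > 0`,
`s ≥ 1`), in `ℝ≥0∞`: `d + a = (d + ⌊a⌋) + {a}` gives `(d+a)² ≥ n²` (`n = d + ⌊a⌋ ≥ 0`) or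
`≥ (n+1)²` (`n ≤ −1`), so the sum is at most `2Σ_{k≥0}(k² + b²)^{-s} ≤ 2b^{-2s} + πb^{1-2s}`
(`sum_range_sq_add_sq_rpow_neg_le`). [folklore] -/
theorem tsum_int_sq_add_sq_rpow_neg_le (a : ℝ) {b s : ℝ} (hb : 0 < b) (hs : 1 ≤ s) :
    ∑' d : ℤ, ENNReal.ofReal ((((d : ℝ) + a) ^ 2 + b ^ 2) ^ (-s)) ≤
      ENNReal.ofReal (2 * b ^ (-(2 * s)) + π * b ^ (1 - 2 * s)) := by
  -- the comparison sequence
  set g : ℤ → ℝ := fun n ↦ ((if 0 ≤ n then (n : ℝ) else (n : ℝ) + 1) ^ 2 + b ^ 2) ^ (-s) with hg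
  have hpt : ∀ d : ℤ, (((d : ℝ) + a) ^ 2 + b ^ 2) ^ (-s) ≤ g (d + ⌊a⌋) := by
    intro d
    rw [hg]
    dsimp only
    apply Real.rpow_le_rpow_of_nonpos (by positivity) ?_ (by linarith)
    have hfr0 : 0 ≤ Int.fract a := Int.fract_nonneg a
    have hfr1 : Int.fract a < 1 := Int.fract_lt_one a
    have hda : (d : ℝ) + a = ((d + ⌊a⌋ : ℤ) : ℝ) + Int.fract a := by
      push_cast
      linarith [Int.floor_add_fract a]
    rw [hda]
    set n : ℤ := d + ⌊a⌋ with hn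
    by_cases h0 : 0 ≤ n
    · rw [if_pos h0]
      have hn0 : (0 : ℝ) ≤ n := by exact_mod_cast h0
      nlinarith
    · rw [if_neg h0]
      have hn1 : (n : ℝ) + 1 ≤ 0 := by
        have : n + 1 ≤ 0 := by omega
        exact_mod_cast this
      have hprod : 0 ≤ (1 - Int.fract a) * (-(2 * (n : ℝ) + Int.fract a + 1)) :=
        mul_nonneg (by linarith) (by linarith)
      nlinarith
  -- shift
  have hshift : ∑' d : ℤ, ENNReal.ofReal (g (d + ⌊a⌋)) = ∑' n : ℤ, ENNReal.ofReal (g n) :=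
    (Equiv.addRight ⌊a⌋).tsum_eq (fun n ↦ ENNReal.ofReal (g n))
  -- split into `n ≥ 0` and `n < 0`
  have hsplit : ∑' n : ℤ, ENNReal.ofReal (g n) =
      ∑' k : ℕ, ENNReal.ofReal (((k : ℝ) ^ 2 + b ^ 2) ^ (-s)) +
        ∑' k : ℕ, ENNReal.ofReal (((k : ℝ) ^ 2 + b ^ 2) ^ (-s)) := by
    rw [tsum_of_nat_of_neg_add_one ENNReal.summable ENNReal.summable]
    have e1 : ∀ k : ℕ, g (k : ℤ) = ((k : ℝ) ^ 2 + b ^ 2) ^ (-s) := fun k ↦ by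
      rw [hg]
      dsimp only
      rw [if_pos (Int.natCast_nonneg k), Int.cast_natCast]
    have e2 : ∀ k : ℕ, g (-(k + 1 : ℤ)) = ((k : ℝ) ^ 2 + b ^ 2) ^ (-s) := fun k ↦ by
      rw [hg]
      dsimp only
      have hneg : ¬ (0 : ℤ) ≤ -(k + 1 : ℤ) := by omega
      rw [if_neg hneg]
      have hk : (((-((k : ℤ) + 1) : ℤ) : ℝ) + 1) ^ 2 = (k : ℝ) ^ 2 := by push_cast; ring
      rw [hk]
    have h1 : ∑' k : ℕ, ENNReal.ofReal (g (k : ℤ)) = ∑' k : ℕ, ENNReal.ofReal (((k : ℝ) ^ 2 + b ^ 2) ^ (-s)) :=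
      tsum_congr fun k ↦ by rw [e1]
    have h2 : ∑' k : ℕ, ENNReal.ofReal (g (-(k + 1 : ℤ))) = ∑' k : ℕ, ENNReal.ofReal (((k : ℝ) ^ 2 + b ^ 2) ^ (-s)) :=
      tsum_congr fun k ↦ by rw [e2]
    rw [h1]
    exact congrArg _ h2
  -- the `ℕ`-sum
  have hnat : ∑' k : ℕ, ENNReal.ofReal (((k : ℝ) ^ 2 + b ^ 2) ^ (-s)) ≤
      ENNReal.ofReal (b ^ (-(2 * s)) + π / 2 * b ^ (1 - 2 * s)) := by
    rw [tsum_eq_zero_add' ENNReal.summable]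
    simp only [Nat.cast_zero, ne_eq, OfNat.ofNat_ne_zero, not_false_eq_true, zero_pow, zero_add]
    rw [ENNReal.ofReal_add (Real.rpow_nonneg hb.le _) (by positivity)]
    have hb2 : (b ^ 2) ^ (-s) = b ^ (-(2 * s)) := by
      rw [← Real.rpow_natCast b 2, ← Real.rpow_mul hb.le]; norm_num
    rw [hb2]
    refine add_le_add le_rfl ?_
    refine ENNReal.tsum_le_of_sum_range_le fun K ↦ ?_
    rw [← ENNReal.ofReal_sum_of_nonneg (fun i _ ↦ by positivity)]
    refine ENNReal.ofReal_le_ofReal ?_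
    refine le_trans (le_of_eq (Finset.sum_congr rfl fun i _ ↦ ?_)) (sum_range_sq_add_sq_rpow_neg_le hb hs K)
    push_cast
    ring_nf
  calc ∑' d : ℤ, ENNReal.ofReal ((((d : ℝ) + a) ^ 2 + b ^ 2) ^ (-s))
      ≤ ∑' d : ℤ, ENNReal.ofReal (g (d + ⌊a⌋)) := ENNReal.tsum_le_tsum fun d ↦ ENNReal.ofReal_le_ofReal (hpt d)
    _ = _ := hshift
    _ = _ := hsplit
    _ ≤ ENNReal.ofReal (b ^ (-(2 * s)) + π / 2 * b ^ (1 - 2 * s)) +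
          ENNReal.ofReal (b ^ (-(2 * s)) + π / 2 * b ^ (1 - 2 * s)) := add_le_add hnat hnat
    _ = ENNReal.ofReal (2 * b ^ (-(2 * s)) + π * b ^ (1 - 2 * s)) := by
        rw [← ENNReal.ofReal_add (by positivity) (by positivity)]
        congr 1
        ring

end RowBound

/-! ### Rows and their sum over `c` -/

section ColumnSum

/-- An even family on `ℤ` vanishing at `0` sums to twice its tail over `n ≥ 1` (in `ℝ≥0∞`). [folklore] -/
theorem tsum_int_eq_two_mul_of_symm {G : ℤ → ℝ≥0∞} (h0 : G 0 = 0) (hsymm : ∀ n : ℤ, G (-n) = G n) :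
    ∑' n : ℤ, G n = 2 * ∑' k : ℕ, G ((k : ℤ) + 1) := by
  rw [tsum_of_nat_of_neg_add_one ENNReal.summable ENNReal.summable, tsum_eq_zero_add' ENNReal.summable]
  simp only [Nat.cast_zero, h0, zero_add, Nat.cast_add, Nat.cast_one, two_mul]
  congr 1
  refine tsum_congr fun k ↦ ?_
  rw [hsymm]

/-- The row `c = 0`: `Σ_{d∈ℤ} (y/d²)ˢ = 2yˢζ⁺(2s) ≤ 4yˢ` (`s > 1`, `ζ⁺(2s) ≤ 2`; the term `d = 0`
is `0`), in `ℝ≥0∞`. [folklore] -/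
theorem tsum_int_row_zero_le {y s : ℝ} (hy : 0 < y) (hs : 1 < s) :
    ∑' d : ℤ, ENNReal.ofReal ((y / (d : ℝ) ^ 2) ^ s) ≤ ENNReal.ofReal (4 * y ^ s) := by
  have hs0 : 0 < s := by linarith
  rw [tsum_int_eq_two_mul_of_symm (by simp [Real.zero_rpow hs0.ne']) (fun n ↦ by simp)]
  have hterm : ∀ k : ℕ, ENNReal.ofReal ((y / (((k : ℤ) + 1 : ℤ) : ℝ) ^ 2) ^ s) =
      ENNReal.ofReal (y ^ s) * ENNReal.ofReal (((k + 1 : ℕ) : ℝ) ^ (-(2 * s))) := by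
    intro k
    rw [← ENNReal.ofReal_mul (Real.rpow_nonneg hy.le _)]
    congr 1
    have hk : (0 : ℝ) < (k : ℝ) + 1 := by positivity
    rw [show ((((k : ℤ) + 1 : ℤ)) : ℝ) = (k : ℝ) + 1 by push_cast; ring,
      Real.div_rpow hy.le (by positivity), Nat.cast_add, Nat.cast_one,
      Real.rpow_neg hk.le, div_eq_mul_inv]
    congr 2
    rw [← Real.rpow_natCast _ 2, ← Real.rpow_mul hk.le]
    norm_num
  simp_rw [hterm]
  rw [ENNReal.tsum_mul_left]
  have hsum : Summable fun m : ℕ+ ↦ ((m : ℕ) : ℝ) ^ (-(2 * s)) :=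
    (Real.summable_nat_rpow.mpr (by linarith : -(2 * s) < -1)).comp_injective PNat.coe_injective
  have hζ : ∑' k : ℕ, ENNReal.ofReal (((k + 1 : ℕ) : ℝ) ^ (-(2 * s))) ≤ ENNReal.ofReal 2 := by
    have heq : ∑' k : ℕ, ENNReal.ofReal (((k + 1 : ℕ) : ℝ) ^ (-(2 * s))) =
        ∑' m : ℕ+, ENNReal.ofReal (((m : ℕ) : ℝ) ^ (-(2 * s))) := by
      rw [← Equiv.pnatEquivNat.symm.tsum_eq]
      refine tsum_congr fun k ↦ ?_
      simp [Equiv.pnatEquivNat, Nat.succPNat]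
    rw [heq, ← ENNReal.ofReal_tsum_of_nonneg (fun m ↦ Real.rpow_nonneg (by positivity) _) hsum]
    refine ENNReal.ofReal_le_ofReal ((tsum_pnat_rpow_neg_le (by linarith : 1 < 2 * s)).trans ?_)
    have : 1 / (2 * s - 1) ≤ 1 := by rw [div_le_one (by linarith)]; linarith
    linarith
  calc 2 * (ENNReal.ofReal (y ^ s) * ∑' k : ℕ, ENNReal.ofReal (((k + 1 : ℕ) : ℝ) ^ (-(2 * s))))
      ≤ 2 * (ENNReal.ofReal (y ^ s) * ENNReal.ofReal 2) := by gcongr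
    _ = ENNReal.ofReal (4 * y ^ s) := by
        rw [← ENNReal.ofReal_mul (Real.rpow_nonneg hy.le _), show (2 : ℝ≥0∞) = ENNReal.ofReal 2 by simp,
          ← ENNReal.ofReal_mul (by norm_num)]
        congr 1
        ring

/-- `|cw + d|² = (cx + d)² + (cy)²`. [folklore] -/
theorem normSq_intCast_mul_add (w : ℍ) (c d : ℤ) :
    Complex.normSq ((c : ℂ) * w + d) = ((c : ℝ) * w.re + d) ^ 2 + ((c : ℝ) * w.im) ^ 2 := by
  rw [Complex.normSq_apply]
  simp [sq]

/-- The rows `c ≠ 0`: `Σ_{d∈ℤ} (y/|cw+d|²)ˢ ≤ yˢ(2(|c|y)^{-2s} + π(|c|y)^{1-2s})` (`s ≥ 1`; the row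
bound with `a = cx`, `b = |c|y`), in `ℝ≥0∞`. [folklore] -/
theorem tsum_int_row_le (w : ℍ) {s : ℝ} (hs : 1 ≤ s) {c : ℤ} (hc : c ≠ 0) :
    ∑' d : ℤ, ENNReal.ofReal ((w.im / Complex.normSq ((c : ℂ) * w + d)) ^ s) ≤
      ENNReal.ofReal (w.im ^ s * (2 * (|(c : ℝ)| * w.im) ^ (-(2 * s)) + π * (|(c : ℝ)| * w.im) ^ (1 - 2 * s))) := by
  have hy := w.im_pos
  have hcy : 0 < |(c : ℝ)| * w.im := mul_pos (abs_pos.mpr (by exact_mod_cast hc)) hy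
  have hterm : ∀ d : ℤ, ENNReal.ofReal ((w.im / Complex.normSq ((c : ℂ) * w + d)) ^ s) =
      ENNReal.ofReal (w.im ^ s) * ENNReal.ofReal ((((d : ℝ) + (c : ℝ) * w.re) ^ 2 + (|(c : ℝ)| * w.im) ^ 2) ^ (-s)) := by
    intro d
    rw [normSq_intCast_mul_add, ← ENNReal.ofReal_mul (Real.rpow_nonneg hy.le _),
      Real.div_rpow hy.le (by positivity), Real.rpow_neg (by positivity), div_eq_mul_inv]
    congr 3
    rw [mul_pow, mul_pow, sq_abs]
    ring
  simp_rw [hterm]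
  rw [ENNReal.tsum_mul_left, ENNReal.ofReal_mul (Real.rpow_nonneg hy.le _)]
  gcongr
  exact tsum_int_sq_add_sq_rpow_neg_le _ hcy hs

/-- The sum over `c ≠ 0` of the row bounds: `Σ_{c≠0} yˢ(2(|c|y)^{-2s} + π(|c|y)^{1-2s})
= 4y^{-s}ζ⁺(2s) + 2πy^{1-s}ζ⁺(2s−1) ≤ 8y^{-s} + 2πy^{1-s}(1 + 1/(2(s−1)))` (`s > 1`), in `ℝ≥0∞`.
[folklore] -/
theorem tsum_int_rowBound_le (w : ℍ) {s : ℝ} (hs : 1 < s) :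
    ∑' c : ℤ, (if c = 0 then 0 else
      ENNReal.ofReal (w.im ^ s * (2 * (|(c : ℝ)| * w.im) ^ (-(2 * s)) + π * (|(c : ℝ)| * w.im) ^ (1 - 2 * s)))) ≤
      ENNReal.ofReal (8 * w.im ^ (-s) + 2 * π * w.im ^ (1 - s) * (1 + 1 / (2 * (s - 1)))) := by
  have hy := w.im_pos
  rw [tsum_int_eq_two_mul_of_symm (by simp) (fun n ↦ by simp)]
  have hterm : ∀ k : ℕ, (if ((k : ℤ) + 1 = 0) then (0 : ℝ≥0∞) else
      ENNReal.ofReal (w.im ^ s * (2 * (|(((k : ℤ) + 1 : ℤ) : ℝ)| * w.im) ^ (-(2 * s)) +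
        π * (|(((k : ℤ) + 1 : ℤ) : ℝ)| * w.im) ^ (1 - 2 * s)))) =
      ENNReal.ofReal (2 * w.im ^ (-s)) * ENNReal.ofReal (((k + 1 : ℕ) : ℝ) ^ (-(2 * s))) +
        ENNReal.ofReal (π * w.im ^ (1 - s)) * ENNReal.ofReal (((k + 1 : ℕ) : ℝ) ^ (-(2 * s - 1))) := by
    intro k
    rw [if_neg (by omega)]
    have hk : (0 : ℝ) < (k : ℝ) + 1 := by positivity
    have habs : |(((k : ℤ) + 1 : ℤ) : ℝ)| = (k : ℝ) + 1 := by
      rw [show (((k : ℤ) + 1 : ℤ) : ℝ) = (k : ℝ) + 1 by push_cast; ring, abs_of_pos hk]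
    rw [habs, ← ENNReal.ofReal_mul (by positivity), ← ENNReal.ofReal_mul (by positivity),
      ← ENNReal.ofReal_add (by positivity) (by positivity)]
    congr 1
    rw [Real.mul_rpow hk.le hy.le, Real.mul_rpow hk.le hy.le, Nat.cast_add, Nat.cast_one]
    have e1 : w.im ^ s * w.im ^ (-(2 * s)) = w.im ^ (-s) := by
      rw [← Real.rpow_add hy]; ring_nf
    have e2 : w.im ^ s * w.im ^ (1 - 2 * s) = w.im ^ (1 - s) := by
      rw [← Real.rpow_add hy]; ring_nf
    have e3 : ((k : ℝ) + 1) ^ (1 - 2 * s) = ((k : ℝ) + 1) ^ (-(2 * s - 1)) := by ring_nf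
    rw [e3]
    calc w.im ^ s * (2 * (((k : ℝ) + 1) ^ (-(2 * s)) * w.im ^ (-(2 * s))) +
          π * (((k : ℝ) + 1) ^ (-(2 * s - 1)) * w.im ^ (1 - 2 * s)))
        = 2 * (w.im ^ s * w.im ^ (-(2 * s))) * ((k : ℝ) + 1) ^ (-(2 * s)) +
          π * (w.im ^ s * w.im ^ (1 - 2 * s)) * ((k : ℝ) + 1) ^ (-(2 * s - 1)) := by ring
      _ = _ := by rw [e1, e2]
  simp_rw [hterm]
  rw [ENNReal.tsum_add, ENNReal.tsum_mul_left, ENNReal.tsum_mul_left]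
  -- the two zeta tails
  have hzeta : ∀ {σ : ℝ}, 1 < σ → ∑' k : ℕ, ENNReal.ofReal (((k + 1 : ℕ) : ℝ) ^ (-σ)) ≤
      ENNReal.ofReal (1 + 1 / (σ - 1)) := by
    intro σ hσ
    have hsum : Summable fun m : ℕ+ ↦ ((m : ℕ) : ℝ) ^ (-σ) :=
      (Real.summable_nat_rpow.mpr (by linarith : -σ < -1)).comp_injective PNat.coe_injective
    have heq : ∑' k : ℕ, ENNReal.ofReal (((k + 1 : ℕ) : ℝ) ^ (-σ)) =
        ∑' m : ℕ+, ENNReal.ofReal (((m : ℕ) : ℝ) ^ (-σ)) := by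
      rw [← Equiv.pnatEquivNat.symm.tsum_eq]
      refine tsum_congr fun k ↦ ?_
      simp [Equiv.pnatEquivNat, Nat.succPNat]
    rw [heq, ← ENNReal.ofReal_tsum_of_nonneg (fun m ↦ Real.rpow_nonneg (by positivity) _) hsum]
    exact ENNReal.ofReal_le_ofReal (tsum_pnat_rpow_neg_le hσ)
  have h1 : ∑' k : ℕ, ENNReal.ofReal (((k + 1 : ℕ) : ℝ) ^ (-(2 * s))) ≤ ENNReal.ofReal 2 := by
    refine (hzeta (by linarith : 1 < 2 * s)).trans (ENNReal.ofReal_le_ofReal ?_)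
    have : 1 / (2 * s - 1) ≤ 1 := by rw [div_le_one (by linarith)]; linarith
    linarith
  have h2 : ∑' k : ℕ, ENNReal.ofReal (((k + 1 : ℕ) : ℝ) ^ (-(2 * s - 1))) ≤
      ENNReal.ofReal (1 + 1 / (2 * (s - 1))) := by
    refine (hzeta (by linarith : 1 < 2 * s - 1)).trans (le_of_eq ?_)
    congr 2
    ring
  calc 2 * (ENNReal.ofReal (2 * w.im ^ (-s)) * ∑' k : ℕ, ENNReal.ofReal (((k + 1 : ℕ) : ℝ) ^ (-(2 * s))) +
        ENNReal.ofReal (π * w.im ^ (1 - s)) * ∑' k : ℕ, ENNReal.ofReal (((k + 1 : ℕ) : ℝ) ^ (-(2 * s - 1))))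
      ≤ 2 * (ENNReal.ofReal (2 * w.im ^ (-s)) * ENNReal.ofReal 2 +
        ENNReal.ofReal (π * w.im ^ (1 - s)) * ENNReal.ofReal (1 + 1 / (2 * (s - 1)))) := by gcongr
    _ = ENNReal.ofReal (8 * w.im ^ (-s) + 2 * π * w.im ^ (1 - s) * (1 + 1 / (2 * (s - 1)))) := by
        have hs1 : 0 < s - 1 := by linarith
        rw [← ENNReal.ofReal_mul (by positivity), ← ENNReal.ofReal_mul (by positivity),
          ← ENNReal.ofReal_add (by positivity) (by positivity), show (2 : ℝ≥0∞) = ENNReal.ofReal 2 by simp,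
          ← ENNReal.ofReal_mul (by norm_num)]
        congr 1
        ring

end ColumnSum

/-! ### The bound `(s − 1) G₁(w, s) ≤ 60(1 + y²)` -/

section MainBound

/-- **The Epstein zeta bound**: `Σ_{p ∈ ℤ²} (y/|p₀w + p₁|²)ˢ ≤ 4yˢ + 8y^{-s} + 2πy^{1-s}(1 +
1/(2(s−1)))` for `s > 1` (in `ℝ≥0∞`; rows `c = 0` and `c ≠ 0`; the classical `E(z, s) ≪ yˢ +
y^{1-s}/(s−1)`, Iwaniec §3.2). [cite: Iwaniec2002, §3.2 (3.20) (E(z,s) ≪ y^σ on 𝒟, σ > 1), PDF p. 44] -/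
theorem tsum_pairs_le (w : ℍ) {s : ℝ} (hs : 1 < s) :
    ∑' p : Fin 2 → ℤ, ENNReal.ofReal ((w.im / Complex.normSq ((p 0 : ℂ) * w + p 1)) ^ s) ≤
      ENNReal.ofReal (4 * w.im ^ s) +
        ENNReal.ofReal (8 * w.im ^ (-s) + 2 * π * w.im ^ (1 - s) * (1 + 1 / (2 * (s - 1)))) := by
  have hy := w.im_pos
  -- to `ℤ × ℤ`
  set e := piFinTwoEquiv fun _ : Fin 2 ↦ ℤ with he
  have hprod : ∑' p : Fin 2 → ℤ, ENNReal.ofReal ((w.im / Complex.normSq ((p 0 : ℂ) * w + p 1)) ^ s) =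
      ∑' c : ℤ, ∑' d : ℤ, ENNReal.ofReal ((w.im / Complex.normSq ((c : ℂ) * w + d)) ^ s) := by
    rw [← e.symm.tsum_eq, ENNReal.tsum_prod']
    refine tsum_congr fun c ↦ tsum_congr fun d ↦ ?_
    simp [he, piFinTwoEquiv]
  rw [hprod]
  -- rows
  have hrow : ∀ c : ℤ, ∑' d : ℤ, ENNReal.ofReal ((w.im / Complex.normSq ((c : ℂ) * w + d)) ^ s) ≤
      (if c = 0 then ENNReal.ofReal (4 * w.im ^ s) else
        ENNReal.ofReal (w.im ^ s * (2 * (|(c : ℝ)| * w.im) ^ (-(2 * s)) + π * (|(c : ℝ)| * w.im) ^ (1 - 2 * s)))) := by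
    intro c
    by_cases hc : c = 0
    · rw [if_pos hc]
      subst hc
      refine le_trans (le_of_eq (tsum_congr fun d ↦ ?_)) (tsum_int_row_zero_le hy hs)
      rw [normSq_intCast_mul_add]
      simp
    · rw [if_neg hc]
      exact tsum_int_row_le w hs.le hc
  refine (ENNReal.tsum_le_tsum hrow).trans ?_
  rw [ENNReal.tsum_eq_add_tsum_ite (0 : ℤ), if_pos rfl]
  gcongr
  refine le_trans (le_of_eq (tsum_congr fun c ↦ ?_)) (tsum_int_rowBound_le w hs)
  by_cases hc : c = 0
  · rw [if_pos hc, if_pos hc]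
  · rw [if_neg hc, if_neg hc, if_neg hc]

/-- For `y ≥ 1/2` and `1 < s ≤ 2`: `yˢ ≤ 1 + y²`, `y^{-s} ≤ 4`, `y^{1-s} ≤ 2`. [folklore] -/
theorem rpow_bounds_of_half_le {y s : ℝ} (hy : 1 / 2 ≤ y) (hs1 : 1 < s) (hs2 : s ≤ 2) :
    y ^ s ≤ 1 + y ^ 2 ∧ y ^ (-s) ≤ 4 ∧ y ^ (1 - s) ≤ 2 := by
  have hy0 : 0 < y := by linarith
  refine ⟨?_, ?_, ?_⟩
  · by_cases h1 : 1 ≤ y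
    · calc y ^ s ≤ y ^ (2 : ℝ) := Real.rpow_le_rpow_of_exponent_le h1 hs2
        _ = y ^ 2 := by norm_cast
        _ ≤ 1 + y ^ 2 := by linarith
    · have : y ^ s ≤ 1 := Real.rpow_le_one hy0.le (le_of_not_ge h1) (by linarith)
      nlinarith [sq_nonneg y]
  · rw [Real.rpow_neg hy0.le, ← Real.inv_rpow hy0.le]
    have hinv : y⁻¹ ≤ 2 := by rw [inv_le_comm₀ hy0 two_pos]; linarith
    calc (y⁻¹) ^ s ≤ (2 : ℝ) ^ s := Real.rpow_le_rpow (inv_nonneg.mpr hy0.le) hinv (by linarith)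
      _ ≤ (2 : ℝ) ^ (2 : ℝ) := Real.rpow_le_rpow_of_exponent_le one_le_two hs2
      _ = 4 := by norm_num
  · rw [show (1 : ℝ) - s = -(s - 1) by ring, Real.rpow_neg hy0.le, ← Real.inv_rpow hy0.le]
    have hinv : y⁻¹ ≤ 2 := by rw [inv_le_comm₀ hy0 two_pos]; linarith
    calc (y⁻¹) ^ (s - 1) ≤ (2 : ℝ) ^ (s - 1) := Real.rpow_le_rpow (inv_nonneg.mpr hy0.le) hinv (by linarith)
      _ ≤ (2 : ℝ) ^ (1 : ℝ) := Real.rpow_le_rpow_of_exponent_le one_le_two (by linarith)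
      _ = 2 := Real.rpow_one 2

/-- **The uniform bound `(s − 1) G₁(w, s) ≤ 60 (1 + (Im w)²)`** for `Im w ≥ 1/2` and `1 < s ≤ 2`,
`G₁(w, s) = Σ_{(c,d)=1}(y/|cw+d|²)ˢ = 2E(w, s)`: drop the coprimality (`tsum_pairs_le`) and use
`rpow_bounds_of_half_le`, `π ≤ 4`. In particular `(s−1)E(w,s)` is bounded on `𝒟` uniformly in
`s ∈ (1, 2]` by `30(1 + (Im w)²)` (the majorant for the dominated convergence `s → 1⁺` in the
Rankin–Selberg identity). [cite: Iwaniec2002, §3.2 (3.20) & (3.26), PDF pp. 44, 47] -/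
theorem sub_one_mul_tsum_coprime_le (w : ℍ) (hw : 1 / 2 ≤ w.im) {s : ℝ} (hs1 : 1 < s) (hs2 : s ≤ 2) :
    (s - 1) * ∑' v : {v : Fin 2 → ℤ // IsCoprime (v 0) (v 1) ∧ ((1 : ℕ) : ℤ) ∣ v 0},
        (w.im / Complex.normSq ((v.1 0 : ℂ) * w + v.1 1)) ^ s ≤ 60 * (1 + w.im ^ 2) := by
  have hy := w.im_pos
  have hq : ∀ p : Fin 2 → ℤ, 0 ≤ w.im / Complex.normSq ((p 0 : ℂ) * w + p 1) := fun p ↦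
    div_nonneg hy.le (Complex.normSq_nonneg _)
  have hsumC : Summable fun v : {v : Fin 2 → ℤ // IsCoprime (v 0) (v 1) ∧ ((1 : ℕ) : ℤ) ∣ v 0} ↦
      (w.im / Complex.normSq ((v.1 0 : ℂ) * w + v.1 1)) ^ s :=
    (summable_rpow_im_div_normSq w hs1).comp_injective Subtype.val_injective
  -- `G₁ ≤ B`
  set B : ℝ := 4 * w.im ^ s + (8 * w.im ^ (-s) + 2 * π * w.im ^ (1 - s) * (1 + 1 / (2 * (s - 1)))) with hB
  have hs1' : 0 < s - 1 := by linarith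
  have hBnn : 0 ≤ B := by positivity
  have hG : ∑' v : {v : Fin 2 → ℤ // IsCoprime (v 0) (v 1) ∧ ((1 : ℕ) : ℤ) ∣ v 0},
      (w.im / Complex.normSq ((v.1 0 : ℂ) * w + v.1 1)) ^ s ≤ B := by
    rw [← ENNReal.ofReal_le_ofReal_iff hBnn, ENNReal.ofReal_tsum_of_nonneg (fun v ↦ Real.rpow_nonneg (hq _) _) hsumC,
      hB, ENNReal.ofReal_add (by positivity) (by positivity)]
    refine le_trans ?_ (tsum_pairs_le w hs1)
    exact ENNReal.tsum_comp_le_tsum_of_injective Subtype.val_injective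
      (fun p : Fin 2 → ℤ ↦ ENNReal.ofReal ((w.im / Complex.normSq ((p 0 : ℂ) * w + p 1)) ^ s))
  -- numerics
  obtain ⟨b1, b2, b3⟩ := rpow_bounds_of_half_le hw hs1 hs2
  have hπ := Real.pi_le_four
  have hπ0 := Real.pi_pos.le
  have hs1le : s - 1 ≤ 1 := by linarith
  calc (s - 1) * ∑' v : {v : Fin 2 → ℤ // IsCoprime (v 0) (v 1) ∧ ((1 : ℕ) : ℤ) ∣ v 0},
        (w.im / Complex.normSq ((v.1 0 : ℂ) * w + v.1 1)) ^ s
      ≤ (s - 1) * B := mul_le_mul_of_nonneg_left hG hs1'.le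
    _ = (s - 1) * (4 * w.im ^ s + 8 * w.im ^ (-s) + 2 * π * w.im ^ (1 - s)) + π * w.im ^ (1 - s) := by
        rw [hB]
        field_simp
        ring
    _ ≤ 1 * (4 * (1 + w.im ^ 2) + 8 * 4 + 2 * π * 2) + π * 2 := by
        gcongr
    _ ≤ 60 * (1 + w.im ^ 2) := by nlinarith [sq_nonneg w.im]

end MainBound

/-! ### Automorphy of `G₁` and `G_N ≤ G₁` -/

section Invariance

/-- `G₁(Az, s) = G₁(z, s)` for `A ∈ SL(2, ℤ)` and real `s` (automorphy of `E(z, s)`, the tree's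
`eisensteinE_smul`). [folklore] -/
theorem tsum_coprime_smul (A : SL(2, ℤ)) (z : ℍ) (s : ℝ) :
    ∑' v : {v : Fin 2 → ℤ // IsCoprime (v 0) (v 1) ∧ ((1 : ℕ) : ℤ) ∣ v 0},
        ((A • z).im / Complex.normSq ((v.1 0 : ℂ) * (A • z : ℍ) + v.1 1)) ^ s =
      ∑' v : {v : Fin 2 → ℤ // IsCoprime (v 0) (v 1) ∧ ((1 : ℕ) : ℤ) ∣ v 0},
        (z.im / Complex.normSq ((v.1 0 : ℂ) * z + v.1 1)) ^ s := by
  apply Complex.ofReal_injective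
  rw [ofReal_tsum_coprime_eq_two_mul_eisensteinE, ofReal_tsum_coprime_eq_two_mul_eisensteinE,
    eisensteinE_smul]

/-- `G_N(z, s) ≤ G₁(z, s)` for `s > 1` (a sub-sum of nonnegative terms). [folklore] -/
theorem tsum_coprime_dvd_le_tsum_coprime (z : ℍ) {s : ℝ} (hs : 1 < s) (N : ℕ) :
    ∑' v : {v : Fin 2 → ℤ // IsCoprime (v 0) (v 1) ∧ (N : ℤ) ∣ v 0},
        (z.im / Complex.normSq ((v.1 0 : ℂ) * z + v.1 1)) ^ s ≤
      ∑' v : {v : Fin 2 → ℤ // IsCoprime (v 0) (v 1) ∧ ((1 : ℕ) : ℤ) ∣ v 0},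
        (z.im / Complex.normSq ((v.1 0 : ℂ) * z + v.1 1)) ^ s := by
  have hq : ∀ p : Fin 2 → ℤ, 0 ≤ z.im / Complex.normSq ((p 0 : ℂ) * z + p 1) := fun p ↦
    div_nonneg z.im_pos.le (Complex.normSq_nonneg _)
  have hsum := summable_rpow_im_div_normSq z hs
  refine Summable.tsum_le_tsum_of_inj
    (fun v : {v : Fin 2 → ℤ // IsCoprime (v 0) (v 1) ∧ (N : ℤ) ∣ v 0} ↦
      (⟨v.1, v.2.1, by simp⟩ : {v : Fin 2 → ℤ // IsCoprime (v 0) (v 1) ∧ ((1 : ℕ) : ℤ) ∣ v 0}))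
    (fun v w h ↦ Subtype.ext (by simpa using congrArg Subtype.val h)) (fun c _ ↦ Real.rpow_nonneg (hq _) _)
    (fun v ↦ le_rfl) (hsum.comp_injective Subtype.val_injective) (hsum.comp_injective Subtype.val_injective)

end Invariance

end Literature.NumberTheory.EllipticCurves.ModularForms

end
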